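import Literature.Analysis.FluidPDE.DeRosaPerturbationNSR
import Literature.Analysis.FluidPDE.DeRosaPertEnergyRate
import Literature.Analysis.FluidPDE.DeRosaPertIncrement
import Literature.Analysis.FluidPDE.DeRosaPertEnergy
import Literature.Analysis.FluidPDE.DeRosaPertDissipative
import Literature.Analysis.FluidPDE.DeRosaPertEulerStress
import HarnessLib

/-!
# De Rosa's perturbation stage: discharge of `DeRosa.perturbationStage`

L. De Rosa, *Infinitely many Leray–Hopf solutions for the fractional Navier–Stokes equations*,
Comm. PDE 44 (2019) 335–365 = arXiv:1801.10235, §§5.3–5.5. The named fact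
`DeRosa.perturbationStage` (`DeRosaThreeStages.lean`) follows from the assembly
`DeRosa.perturbationStage_of_parts` (`DeRosaPerturbation.lean`) applied to its six parts, all
proved in the tree: part 0 (`DeRosa.core_part`, Lemma 5.9, `DeRosaPertEnergyRate.lean`), part 1
(`DeRosa.increment_part`, Prop. 5.11, `DeRosaPertIncrement.lean`), part 2 (`DeRosa.nsrPart_proof`,
§5.5, `DeRosaPerturbationNSR.lean`), part 3 (`DeRosa.euler_stress_part`, Prop. 5.13 for `R̊^E`,
`DeRosaPertEulerStress.lean`), part 4 (`DeRosa.dissipative_part`, Prop. 5.13 for `R̊^D`,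
`DeRosaPertDissipative.lean`), part 5 (`DeRosa.energy_part`, Prop. 5.12, `DeRosaPertEnergy.lean`).

## References

* L. De Rosa, Comm. PDE 44 (2019) 335–365 = arXiv:1801.10235, §5.3 (5.19)–(5.21), §5.5
  Props. 5.11–5.13. [`Derosa2018`]
-/

namespace Literature.Analysis.FluidPDE

namespace DeRosa

/-- **De Rosa's perturbation stage holds** (§§5.3–5.5: from the glued NSR triple with (5.15)–(5.17),
a spatial Hölder bound above `γ` and the energy gap, a new NSR triple with (5.19)–(5.21) whose
time-zero velocity depends on `e`, `v̄_q` only through `e(0)`, `v̄_q(·,0)`).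
[cite: Derosa2018, §5.3 (5.19)–(5.21) and §5.5 Props. 5.11–5.13] -/
theorem perturbationStage_holds : perturbationStage :=
  perturbationStage_of_parts core_part increment_part (fun 𝔚 _ hc₀ Cη => nsrPart_proof 𝔚 hc₀ Cη)
    euler_stress_part dissipative_part energy_part

end DeRosa

end Literature.Analysis.FluidPDE
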